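import Literature.Probability.Distributions.IndepProductLawDistance
import Literature.InformationTheory.Coding.DualDistance
import Mathlib.Data.ZMod.Basic
import Mathlib.Algebra.Order.Floor.Ring
import HarnessLib

/-!
# The query of the Micciancio–Regev combining procedure is uniform (MR07 Lemma 5.8, first property), fine-grid form

Topic `Algebra/EuclideanLattices` (family `pqc`). Theorems only (no definitions, no named facts).
Companion of `MRCombiningProcedure.lean` (the deterministic second and third properties of
**Micciancio–Regev 2007, Lemma 5.8**, authors' version pp. 20–21) and of
`GaussianSublatticeUniformity.lean` (Lemma 5.7 in the fine-grid form a bit-level reduction must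
use: the offset `c` lives in the finite group `L'/L(B)` of a superlattice `L' ⊇ L(B)`, and is
within `2ε/(1+ε)` of uniform), written for the decomposition of the named facts
`Literature.Computability.Cryptography.MicciancioRegev2007_gapCVP'_to_SIS'` (Thm. 5.23 proper) and
`Literature.Computability.Cryptography.owfExist_of_gapSVP_worstCaseHard` (whose remaining hypothesis,
`GapSVPFromGIVP.lean`, is the machine-level Cor. 5.13 = Thm. 5.9, which runs the same combining
procedure).

## The printed argument and its fine-grid form

Lemma 5.8, first property (p. 21): "if `c` is uniformly distributed in `P(B)` and `v` is chosen
uniformly from the vectors in `L(B) mod P(S)`, then `c + v mod P(S)` is distributed uniformly in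
`P(S)`. This holds since the sets `(v + P(B)) mod P(S)` for all `v ∈ L(B) mod P(S)` form a partition
of `P(S)` into sets of equal volume. Thus … `W` is distributed uniformly in `P(S)ᵐ`. From this, it
easily follows that `A` \[`aᵢ = ⌊q S⁻¹ wᵢ⌋`\] is distributed uniformly in `ℤ_q^{n×m}`."

In the fine-grid model (`L' = L(S)/M ⊇ L(B) ⊇ L(S)` with `M = q·d`), everything is a statement
about finite groups: `G = L'/L(S)`, identified with `(ℤ/Mℤ)ⁿ` by `S`-coordinates
(`S (k/M) ↦ k mod M`; the reduced representative `w ∈ P(S)` has `S⁻¹ w = k/M`, `k ∈ [0, M)ⁿ`, i.e.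
`k = val`), the offsets live in `Q = L'/L(B)`, which is `G` modulo the subgroup `L(B)/L(S)`; we fix
any surjection `ψ : G →+ Q` with that kernel and any choice `rep : Q → G` of representatives
(`ψ ∘ rep = id`, MR07's reduction into `P(B)`); "`v` uniform in `L(B) mod P(S)`" is `v ∼ U(ker ψ)`;
`w = rep c + v`; and the query is `aⱼ = ⌊q · kⱼ/M⌋ = ⌊kⱼ/d⌋` (`floor_mul_div_mul`).

## Results

* `MicciancioRegev2007.pad_bijective`, `uniform_bind_pad` — **the partition argument**:
  `(a, h) ↦ rep a + h : Q × ker ψ → G` is a bijection, so for `c ∼ U(Q)` and an independent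
  `v ∼ U(ker ψ)`, `rep c + v ∼ U(G)`; `tvDist_bind_pad_uniform_le` — for ANY law `μ` of `c`,
  `Δ(law(rep c + v), U(G)) ≤ Δ(μ, U(Q))` (kernel contraction).
* `map_divRound_uniformOfFintype` — **the rounding step**: for `M = q·d`, `k ↦ ⌊k/d⌋ (mod q)` pushes
  `U(ℤ/Mℤ)` to `U(ℤ/qℤ)` (every fibre is an interval of length `d`); coordinatewise on `(ℤ/Mℤ)ⁿ`,
  `map_pi_divRound_uniformOfFintype`; `floor_mul_div_mul` identifies `⌊q · (v/M)⌋` (the printed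
  `⌊q S⁻¹ w⌋`, cf. `MicciancioRegev2007.combine_mem`) with `v / d`.
* `MicciancioRegev2007.map_query_uniform` — **Lemma 5.8 (i), one column, exact**: for `c ∼ U(Q)`,
  `v ∼ U(ker ψ)`, the query column `(⌊(rep c + v)ⱼ/d⌋ mod q)ⱼ` is uniform on `(ℤ/qℤ)ⁿ`;
  `tvDist_query_uniform_le` — for `c ∼ μ`, its distance from uniform is `≤ Δ(μ, U(Q))`.
* `MicciancioRegev2007.tvDist_indepLaw_query_le` — **`m` independent columns** (MR07 eq. (13) with
  Lemma 5.8 (i)): if the offsets `cᵢ ∼ μᵢ` are independent (each with its own fresh `vᵢ`), the query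
  `A ∈ (ℤ/qℤ)^{n×m}` satisfies `Δ(law A, U) ≤ ∑ᵢ Δ(μᵢ, U(Q))`; `…_matrix_le` — the same after
  transposition into the tree's `Matrix (Fin n) (Fin m) (ZMod q)` convention of `SIS.successProb`.
  With `GaussianSublatticeUniformity`'s `tvDist_gridSample_fst_le` (`Δ(μᵢ, U) ≤ 2ε/(1+ε)` for
  `s ≥ η_ε(L(B))`) this is the printed "`H` holds with probability at least `δ_{j,α} − εm/2`" up to
  the immaterial constant, via `PMF.abs_toReal_toOuterMeasure_bind_sub_le_tvDist` for the oracle call.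

## References

* D. Micciancio, O. Regev, *Worst-case to average-case reductions based on Gaussian measures*,
  SIAM J. Comput. 37 (2007) 267–302; authors' version (`lit read doi:10.1137/S0097539705447360`),
  Lemma 5.8 and its proof (pp. 20–21: steps 1–3 of `A_F` and "We now prove the first property"),
  Thm. 5.9 proof, eq. (13) (p. 23).
* O. Goldreich, *Foundations of Cryptography I*, CUP 2001, §3.2 (statistical distance under
  processing) [Goldreich2001].

Reused, not restated: `Literature.InformationTheory.Coding.map_uniformOfFintype_of_bijective`
(bijections preserve uniform laws), `Literature.Probability.Distributions.map_uniformOfFintype_of_card_fiber`,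
`map_pi_uniformOfFintype`, `tvDist_indepLaw_uniformOfFintype_le`, `PMF.tvDist_bind_left_le`.
-/

noncomputable section

open scoped ENNReal
open PMF Literature.Probability.Distributions
open Literature.InformationTheory.Coding (map_uniformOfFintype_of_bijective)

namespace Literature.Algebra.EuclideanLattices

/-! ### The partition argument: uniform coset representative plus uniform subgroup element -/

namespace MicciancioRegev2007

section Pad

variable {G Q : Type*} [AddCommGroup G] [Fintype G] [AddCommGroup Q] [Fintype Q] [DecidableEq Q]
  (ψ : G →+ Q) (rep : Q → G)

omit [Fintype G] [Fintype Q] [DecidableEq Q] in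
/-- **The partition behind MR07 Lemma 5.8 (i)**: if `rep` chooses a representative of each class
(`ψ (rep a) = a`), then `(a, h) ↦ rep a + h` is a bijection `Q × ker ψ → G` ("the sets
`(v + P(B)) mod P(S)` for `v ∈ L(B) mod P(S)` form a partition of `P(S)` into sets of equal volume",
p. 21, in the finite group `G = L'/L(S)` with `ker ψ = L(B)/L(S)`, `Q = L'/L(B)`).
[cite: MicciancioRegev2007, Lemma 5.8 (proof of the first property, p. 21)] -/
theorem pad_bijective (hrep : ∀ a, ψ (rep a) = a) :
    Function.Bijective fun p : Q × ψ.ker => rep p.1 + (p.2 : G) := by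
  refine ⟨?_, fun g => ⟨(ψ g, ⟨g - rep (ψ g), ?_⟩), ?_⟩⟩
  · rintro ⟨a, h⟩ ⟨a', h'⟩ hEq
    dsimp only at hEq
    have ha : a = a' := by
      have := congrArg ψ hEq
      rwa [map_add, map_add, hrep, hrep, (AddMonoidHom.mem_ker).1 h.2,
        (AddMonoidHom.mem_ker).1 h'.2, add_zero, add_zero] at this
    subst ha
    rw [Prod.mk.injEq, Subtype.ext_iff]
    exact ⟨rfl, add_left_cancel hEq⟩
  · rw [AddMonoidHom.mem_ker, map_sub, hrep, sub_self]
  · dsimp only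
    abel

/-- `|G| = |Q| · |ker ψ|` (Lagrange, through the bijection `pad_bijective`). [folklore] -/
theorem card_eq_card_mul_card_ker (hrep : ∀ a, ψ (rep a) = a) :
    Fintype.card G = Fintype.card Q * Fintype.card ψ.ker := by
  rw [← Fintype.card_prod, Fintype.card_of_bijective (pad_bijective ψ rep hrep)]

/-- **MR07 Lemma 5.8, first property, group form (exact)**: if `c ∼ U(Q)` and, independently,
`v ∼ U(ker ψ)` ("a uniformly random lattice vector `v ∈ L(B) mod P(S)`"), then
`w = rep c + v ∼ U(G)` ("`c + v mod P(S)` is distributed uniformly in `P(S)`").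
[cite: MicciancioRegev2007, Lemma 5.8 (first property, p. 21)] -/
theorem uniform_bind_pad (hrep : ∀ a, ψ (rep a) = a) :
    ((PMF.uniformOfFintype Q).bind fun a =>
        (PMF.uniformOfFintype ψ.ker).map fun h : ψ.ker => rep a + (h : G)) = PMF.uniformOfFintype G := by
  have hker : ∀ g : G, g - rep (ψ g) ∈ ψ.ker := fun g => by
    rw [AddMonoidHom.mem_ker, map_sub, hrep, sub_self]
  ext g
  rw [PMF.bind_apply, tsum_eq_single (ψ g)]
  · -- the class of `g` contributes exactly one subgroup element, `g - rep (ψ g)`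
    rw [PMF.map_apply, tsum_eq_single (⟨g - rep (ψ g), hker g⟩ : ψ.ker)]
    · rw [if_pos (by simp), PMF.uniformOfFintype_apply, PMF.uniformOfFintype_apply,
        PMF.uniformOfFintype_apply, card_eq_card_mul_card_ker ψ rep hrep, Nat.cast_mul,
        ENNReal.mul_inv (Or.inl (by exact_mod_cast Fintype.card_ne_zero))
          (Or.inl (ENNReal.natCast_ne_top _))]
    · intro h hne
      rw [if_neg]
      intro hg
      exact hne (Subtype.ext (eq_sub_iff_add_eq'.2 hg.symm))
  · -- no other class contributes
    intro a ha
    rw [PMF.map_apply, ENNReal.tsum_eq_zero.2 fun h => ?_, mul_zero]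
    rw [if_neg]
    intro hg
    refine ha ?_
    rw [hg, map_add, hrep, (AddMonoidHom.mem_ker).1 h.2, add_zero]

/-- **MR07 Lemma 5.8, first property, group form (statistical)**: for an offset `c` of ANY law `μ`
on `Q` and an independent `v ∼ U(ker ψ)`, `Δ(law(rep c + v), U(G)) ≤ Δ(μ, U(Q))` — the combining
step is a Markov kernel applied to `c`, and kernels contract statistical distance.
[cite: MicciancioRegev2007, Lemma 5.8 (i) with Thm. 5.9 eq. (13)] -/
theorem tvDist_bind_pad_uniform_le (hrep : ∀ a, ψ (rep a) = a) (μ : PMF Q) :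
    (μ.bind fun a => (PMF.uniformOfFintype ψ.ker).map fun h : ψ.ker => rep a + (h : G)).tvDist
        (PMF.uniformOfFintype G) ≤ μ.tvDist (PMF.uniformOfFintype Q) := by
  conv_lhs => rw [← uniform_bind_pad ψ rep hrep]
  exact tvDist_bind_left_le _ _ _

end Pad

/-! ### The rounding step `a = ⌊q · k/M⌋ = ⌊k/d⌋` for `M = q d` -/

/-- `val` is transported by `ZMod.finEquiv`. [folklore] -/
theorem val_finEquiv : ∀ (M : ℕ) [NeZero M] (i : Fin M), (ZMod.finEquiv M i).val = i
  | 0, h, _ => absurd rfl (@NeZero.ne ℕ _ 0 h)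
  | _ + 1, _, _ => rfl

/-- **The rounding step preserves uniformity**: for `M = q·d` (`q, d ≥ 1`), the map
`k ↦ ⌊k/d⌋ mod q : ℤ/Mℤ → ℤ/qℤ` (with `k` read in `[0, M)`) pushes the uniform law to the uniform
law — each fibre is an interval of `d` consecutive residues ("from this, it easily follows that `A`
is distributed uniformly in `ℤ_q^{n×m}`", p. 21, for `q ∣ M`).
[cite: MicciancioRegev2007, Lemma 5.8 (first property, p. 21)] -/
theorem map_divRound_uniformOfFintype (q d : ℕ) [NeZero q] [NeZero d] :
    (PMF.uniformOfFintype (ZMod (q * d))).map (fun k => ((k.val / d : ℕ) : ZMod q)) =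
      PMF.uniformOfFintype (ZMod q) := by
  -- factor through `Fin (q d) ≃ Fin q × Fin d → Fin q ≃ ZMod q`
  have hfac : (fun k : ZMod (q * d) => ((k.val / d : ℕ) : ZMod q)) =
      (ZMod.finEquiv q) ∘ Prod.fst ∘ finProdFinEquiv.symm ∘ (ZMod.finEquiv (q * d)).symm := by
    funext k
    simp only [Function.comp_apply, finProdFinEquiv_symm_apply]
    apply ZMod.val_injective
    rw [val_finEquiv, Fin.coe_divNat]
    obtain ⟨i, rfl⟩ := (ZMod.finEquiv (q * d)).surjective k
    rw [RingEquiv.symm_apply_apply, val_finEquiv, ZMod.val_natCast,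
      Nat.mod_eq_of_lt (Nat.div_lt_of_lt_mul (i.2.trans_eq (mul_comm q d)))]
  rw [hfac, ← PMF.map_comp, ← PMF.map_comp, ← PMF.map_comp,
    map_uniformOfFintype_of_bijective _ (ZMod.finEquiv (q * d)).symm.bijective,
    map_uniformOfFintype_of_bijective _ finProdFinEquiv.symm.bijective]
  classical
  rw [map_uniformOfFintype_of_card_fiber Prod.fst (NeZero.ne (Fintype.card (Fin d))) fun b => ?_,
    map_uniformOfFintype_of_bijective _ (ZMod.finEquiv q).bijective]
  rw [show (Finset.univ.filter fun p : Fin q × Fin d => p.1 = b) = {b} ×ˢ Finset.univ by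
    ext ⟨x, y⟩; simp [eq_comm], Finset.card_product, Finset.card_singleton, one_mul, Finset.card_univ]

/-- Coordinatewise rounding of a uniform `w ∈ (ℤ/Mℤ)ⁿ` gives a uniform column `a ∈ (ℤ/qℤ)ⁿ`.
[cite: MicciancioRegev2007, Lemma 5.8 (first property, p. 21)] -/
theorem map_pi_divRound_uniformOfFintype (n q d : ℕ) [NeZero q] [NeZero d] :
    (PMF.uniformOfFintype (Fin n → ZMod (q * d))).map
        (fun w j => (((w j).val / d : ℕ) : ZMod q)) = PMF.uniformOfFintype (Fin n → ZMod q) :=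
  map_pi_uniformOfFintype n (fun _ (k : ZMod (q * d)) => ((k.val / d : ℕ) : ZMod q))
    fun _ => map_divRound_uniformOfFintype q d

/-- **The printed query is this rounding**: `⌊q · (v/M)⌋ = v / d` for `M = q·d`, `v ∈ ℕ` — with
`S⁻¹ w = k/M` (`k = val w ∈ [0, M)ⁿ`), MR07's `aᵢ = ⌊q S⁻¹ wᵢ⌋` (the integer matrix fed to
`MicciancioRegev2007.combine_mem` as `⌊q · S.repr w j⌋`) is `⌊kⱼ/d⌋`. [folklore] -/
theorem floor_mul_div_mul (q d v : ℕ) (hq : 0 < q) (hd : 0 < d) :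
    ⌊(q : ℝ) * ((v : ℝ) / ((q : ℝ) * d))⌋ = ((v / d : ℕ) : ℤ) := by
  have hq' : (q : ℝ) ≠ 0 := by exact_mod_cast hq.ne'
  rw [show (q : ℝ) * ((v : ℝ) / ((q : ℝ) * d)) = (v : ℝ) / d by field_simp,
    Int.floor_div_natCast, Int.floor_natCast, Int.natCast_div]

/-! ### Lemma 5.8 (i) in the fine-grid model: one column, and `m` independent columns -/

section Query

variable {n q d : ℕ} [NeZero q] [NeZero d] {Q : Type*} [AddCommGroup Q] [Fintype Q] [DecidableEq Q]
  (ψ : (Fin n → ZMod (q * d)) →+ Q) (rep : Q → Fin n → ZMod (q * d))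

/-- **MR07 Lemma 5.8 (i), one column, exact**: in the fine-grid model `G = (ℤ/Mℤ)ⁿ`, `M = q d`,
with `ψ : G →+ Q` onto the offset group (kernel = `L(B) mod L(S)`) and representatives `rep`: if the
offset `c ∼ U(Q)` and `v ∼ U(ker ψ)` independently, the query column `(⌊(rep c + v)ⱼ/d⌋ mod q)ⱼ` is
uniform on `(ℤ/qℤ)ⁿ`. [cite: MicciancioRegev2007, Lemma 5.8 (first property, p. 21)] -/
theorem map_query_uniform (hrep : ∀ a, ψ (rep a) = a) :
    (((PMF.uniformOfFintype Q).bind fun a =>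
        (PMF.uniformOfFintype ψ.ker).map fun h : ψ.ker => rep a + (h : Fin n → ZMod (q * d))).map
        fun w j => (((w j).val / d : ℕ) : ZMod q)) = PMF.uniformOfFintype (Fin n → ZMod q) := by
  classical
  rw [uniform_bind_pad ψ rep hrep, map_pi_divRound_uniformOfFintype]

/-- **MR07 Lemma 5.8 (i), one column, statistical**: for an offset of any law `μ` (independent
`v ∼ U(ker ψ)`), the query column is within `Δ(μ, U(Q))` of uniform on `(ℤ/qℤ)ⁿ`.
[cite: MicciancioRegev2007, Lemma 5.8 (i) with Thm. 5.9 eq. (13)] -/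
theorem tvDist_query_uniform_le (hrep : ∀ a, ψ (rep a) = a) (μ : PMF Q) :
    ((μ.bind fun a => (PMF.uniformOfFintype ψ.ker).map fun h : ψ.ker => rep a + (h : Fin n → ZMod (q * d))).map
        fun w j => (((w j).val / d : ℕ) : ZMod q)).tvDist (PMF.uniformOfFintype (Fin n → ZMod q)) ≤
      μ.tvDist (PMF.uniformOfFintype Q) := by
  classical
  conv_lhs => rw [← map_query_uniform ψ rep hrep]
  exact (tvDist_map_le_holds _ _ _).trans (tvDist_bind_left_le _ _ _)

/-- **MR07 Lemma 5.8 (i) for the whole query, with eq. (13)**: if the `m` offsets `cᵢ ∼ μᵢ` are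
independent and each column is combined with its own fresh `vᵢ ∼ U(ker ψ)`, the query
`A = (aᵢ)ᵢ ∈ ((ℤ/qℤ)ⁿ)ᵐ` (column `i` = `(⌊(rep cᵢ + vᵢ)ⱼ/d⌋ mod q)ⱼ`) satisfies
`Δ(law A, U) ≤ ∑ᵢ Δ(μᵢ, U(Q))` ("since the vectors `cᵢ` are independent,
`Δ(C, U(P(B)ᵐ)) ≤ ∑ᵢ Δ(cᵢ, U(P(B)))` … on a uniform `C′` the query is also uniform").
[cite: MicciancioRegev2007, Thm. 5.9 proof, eq. (13) and the following paragraph (p. 23)] -/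
theorem tvDist_indepLaw_query_le (hrep : ∀ a, ψ (rep a) = a) (m : ℕ) (μ : Fin m → PMF Q) :
    (indepLaw m fun i => ((μ i).bind fun a => (PMF.uniformOfFintype ψ.ker).map
        fun h : ψ.ker => rep a + (h : Fin n → ZMod (q * d))).map fun w j => (((w j).val / d : ℕ) : ZMod q)).tvDist
        (PMF.uniformOfFintype (Fin m → Fin n → ZMod q)) ≤
      ∑ i, (μ i).tvDist (PMF.uniformOfFintype Q) :=
  (tvDist_indepLaw_uniformOfFintype_le m _).trans
    (Finset.sum_le_sum fun i _ => tvDist_query_uniform_le ψ rep hrep (μ i))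

/-- Transposition `(Fin m → Fin n → R) → Matrix (Fin n) (Fin m) R` preserves the uniform law.
[folklore] -/
theorem map_transpose_uniformOfFintype (m : ℕ) :
    (PMF.uniformOfFintype (Fin m → Fin n → ZMod q)).map (fun A => Matrix.of fun j i => A i j) =
      PMF.uniformOfFintype (Matrix (Fin n) (Fin m) (ZMod q)) :=
  map_uniformOfFintype_of_bijective _
    ⟨fun A B h => funext fun i => funext fun j => by simpa using congrFun (congrFun h j) i,
      fun B => ⟨fun i j => B j i, rfl⟩⟩

/-- **MR07 Lemma 5.8 (i) with eq. (13), in the `SIS` matrix convention** (`A ∈ ℤ_q^{n×m}` with the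
query columns `aᵢ` as columns, `Matrix (Fin n) (Fin m) (ZMod q)` as in
`Literature.Computability.Cryptography.SIS.successProb`): `Δ(law A, U(ℤ_q^{n×m})) ≤ ∑ᵢ Δ(μᵢ, U(Q))`.
[cite: MicciancioRegev2007, Lemma 5.8 (i) and Thm. 5.9 eq. (13)] -/
theorem tvDist_indepLaw_query_matrix_le (hrep : ∀ a, ψ (rep a) = a) (m : ℕ) (μ : Fin m → PMF Q) :
    ((indepLaw m fun i => ((μ i).bind fun a => (PMF.uniformOfFintype ψ.ker).map
        fun h : ψ.ker => rep a + (h : Fin n → ZMod (q * d))).map fun w j => (((w j).val / d : ℕ) : ZMod q)).map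
        (fun A => Matrix.of fun j i => A i j)).tvDist
        (PMF.uniformOfFintype (Matrix (Fin n) (Fin m) (ZMod q))) ≤
      ∑ i, (μ i).tvDist (PMF.uniformOfFintype Q) := by
  rw [← map_transpose_uniformOfFintype]
  exact (tvDist_map_le_holds _ _ _).trans (tvDist_indepLaw_query_le ψ rep hrep m μ)

end Query

end MicciancioRegev2007

end Literature.Algebra.EuclideanLattices

end
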